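import Summits.SmoothPoincare4.SmoothPoincare4.Theses.InformationMetricHadamard
import Literature.Geometry.Riemannian.HadamardExpCovering
import Literature.Topology.CoveringSpaces.CoveringSubsingletonFiber
import Literature.Geometry.GaugeTheory.InstantonEntropy
import Literature.Geometry.Riemannian.RiemannianDistance
import Summits.SmoothPoincare4.SmoothPoincare4.Theorems.InformationMetricHadamardAhHadamardFillingStubCollarPackage
import Summits.SmoothPoincare4.SmoothPoincare4.Theorems.InformationMetricHadamardC0AhRecognitionStubFarCollarImmersive
import Summits.SmoothPoincare4.SmoothPoincare4.Theorems.InformationMetricHadamardC0AhRecognitionStubFarCollarIsFar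
import Summits.SmoothPoincare4.SmoothPoincare4.Theorems.InformationMetricHadamardAhHadamardFillingStubEuclideanOneEnd
import Summits.SmoothPoincare4.SmoothPoincare4.Theorems.InformationMetricHadamardAhHadamardFillingStubCoverSheetsSimplyConnected
import Summits.SmoothPoincare4.SmoothPoincare4.Theorems.InformationMetricHadamardAhHadamardFillingStubCollarSheetData

/-!
# Crux `InformationMetricHadamard.AhHadamardFilling` — line `universal-cover-strips-topology`:
# the sorry-free REDUCTION (crux ⇐ a connected `sec ≤ 0` filling with the collar ⇐ the gauge apex S4)

(item stmt-SmoothPoincare4-6014; lead `prover-line-stmt-SmoothPoincare4-6014-a1-0`, 2026-08-16;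
skeleton `Cruxes/AhHadamardFilling/Lines/universal_cover_strips_topology.lean`, r2.)

With the three soft stubs of the line LANDED —
`stub_euclideanOneEnd` (p124275: `ℝ⁵` has one end), `stub_coverSheetsSimplyConnected` (p124355:
a covering by a one-ended simply connected space is trivial as soon as the base contains an open
set with compact frontier, non-compact closure and closure inside an open simply connected
embedded piece) and `stub_collarSheetData` (p124446: the crux's collar supplies exactly such a
set) — the line's LEVER becomes an unconditional theorem, and so does the reduction of the crux
to its one open stub, the gauge apex `stub_instantonCollarComponentNpc` (S4):

* `closure_image_far_subset_of_collar` — THE CLOSURE CLAUSE IS AUTOMATIC: for a smooth injective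
  `C⁰`-conical collar over a closed `N`, `closure Ψ(N × (0,t)) ⊆ Ψ(N × (0,1))` (deep points are
  far, `C0AhRecognition.Sketch.stub_farCollarIsFar`; bounded-depth pieces are compact).
* `isCompact_setOf_edist_le_of_collar` — COMPLETENESS IS AUTOMATIC: if moreover the far parts are
  co-compact, closed distance balls are compact (a closed ball sits in a compact far complement).
  These two remove the closure clause and the completeness conjunct from the apex (reshape r2).
* `simplyConnected_of_connectedCollarFilling` — SIMPLE CONNECTIVITY IS AUTOMATIC: a CONNECTED
  `sec ≤ 0` Riemannian 5-manifold carrying the crux's collar (co-compact far parts) is simply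
  connected (Cartan–Hadamard covering `exp_p : ℝ⁵ → W`, tree `HadamardExpCovering.expMap_covering`,
  + the three landed stubs).
* `ahHadamardFilling_of_connectedCollarFillings` — the crux BY NAME from: every homotopy 4-sphere
  has a Riemannian `g` and a CONNECTED `sec ≤ 0` Riemannian 5-manifold with the crux's collar
  (all collar clauses; NO completeness, NO simple connectivity asked).
* `ahHadamardFilling_of_instantonCollarComponentNpc` — the crux BY NAME from the registered apex
  S4 (r2 signature: the same data PINNED to the charge-one instanton moduli space
  `AsdModuliSpace g Σ.orientation 1` by a continuous injection `j` and the Fisher–Rao identity for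
  the curvature densities; intended witness = the collar component of `(M₁(Σ,g), g_I)`,
  Groisser–Murray 1997 Thm 3.1, Hitchin 1990).

Everything here is proved (no `sorry`, no new definitions); the apex itself stays open (it is the
route's informal gauge item 7336 made formal, SPC4-strength given crux 6015).
-/

noncomputable section

-- the prescribed namespace `Summit.<P>.<Sub>.…` duplicates `SmoothPoincare4` (P = Sub)
set_option linter.dupNamespace false

open scoped Manifold ContDiff Topology ENNReal NNReal
open Set Function

namespace Summit.SmoothPoincare4.SmoothPoincare4.Cruxes.AhHadamardFilling.UniversalCoverStripsTopology

open Literature.Topology.FourManifolds (HomotopySphere)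
open Literature.Geometry.Lorentzian (PseudoRiemannianMetric)
open Literature.Geometry.GaugeTheory (AsdModuliSpace volMeasure)
open Literature.Geometry.Riemannian.HadamardExpCovering
open Literature.Geometry.Lorentzian.PseudoRiemannianMetric

/-! ## Two clauses of the crux are automatic: the closure clause and completeness -/

section Automatic

variable {N : Type} [TopologicalSpace N] [T2Space N] [SecondCountableTopology N] [CompactSpace N]
  [ChartedSpace (EuclideanSpace ℝ (Fin 4)) N] [IsManifold (𝓡 4) ∞ N]
  (gN : PseudoRiemannianMetric (𝓡 4) ∞ (EuclideanSpace ℝ (Fin 4)) (TangentSpace (𝓡 4) : N → Type _))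
  (hgN : gN.IsRiemannian)
  {W : Type} [TopologicalSpace W] [T2Space W] [SecondCountableTopology W]
  [ChartedSpace (EuclideanSpace ℝ (Fin 5)) W] [IsManifold (𝓡 5) ∞ W]
  (G : PseudoRiemannianMetric (𝓡 5) ∞ (EuclideanSpace ℝ (Fin 5)) (TangentSpace (𝓡 5) : W → Type _))
  (hG : G.IsRiemannian) {c : ℝ} (Ψ : N × ℝ → W) (hc : 0 < c)
  (hsm : ContMDiffOn ((𝓡 4).prod 𝓘(ℝ, ℝ)) (𝓡 5) ∞ Ψ (univ ×ˢ Ioo (0 : ℝ) 1))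
  (hinj : InjOn Ψ (univ ×ˢ Ioo (0 : ℝ) 1))
  (hasym : ∀ ε : ℝ, 0 < ε → ∃ t ∈ Ioo (0 : ℝ) 1, ∀ (y : N) (l : ℝ), l ∈ Ioo (0 : ℝ) t →
    ∀ (v : TangentSpace (𝓡 4) y) (s : ℝ),
      |G.val (Ψ (y, l)) (mfderiv ((𝓡 4).prod 𝓘(ℝ, ℝ)) (𝓡 5) Ψ (y, l) (v, s))
          (mfderiv ((𝓡 4).prod 𝓘(ℝ, ℝ)) (𝓡 5) Ψ (y, l) (v, s)) -
        c * (s ^ 2 + gN.val y v v) / l ^ 2| ≤ ε * (c * (s ^ 2 + gN.val y v v) / l ^ 2))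

include hgN hG hc hsm hinj hasym

/-- **The closure clause is automatic.** For a collar map `Ψ : N × (0,1) → W⁵` over a closed
4-manifold `N` which is smooth and injective on the strip and `C⁰`-conical
(`G ∘ dΨ = (1 + o(1)) c (dl² + gN)/l²`, `c > 0`, `gN` Riemannian), the closure of every far part
`Ψ(N × (0,t))`, `t < 1`, stays inside the collar image `Ψ(N × (0,1))`: deep points are metrically
far (`C0AhRecognition.Sketch.stub_farCollarIsFar`, fed by `stub_farCollarImmersive`), so a closure
point `p` is not a limit of points below the depth `t'` at which everything is at distance `> 1`
from `p`; hence it is a limit of points of `Ψ(N × [t',t])`, a compact — closed — subset of the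
collar image. [folklore] -/
theorem closure_image_far_subset_of_collar :
    ∀ t ∈ Ioo (0 : ℝ) 1, closure (Ψ '' (univ ×ˢ Ioo (0 : ℝ) t)) ⊆ Ψ '' (univ ×ˢ Ioo (0 : ℝ) 1) := by
  haveI : LocallyCompactSpace W := ChartedSpace.locallyCompactSpace (EuclideanSpace ℝ (Fin 5)) W
  obtain ⟨t₀, ht₀, himm⟩ := C0AhRecognition.Sketch.stub_farCollarImmersive N gN hgN W G c Ψ hc hasym
  have hfar := C0AhRecognition.Sketch.stub_farCollarIsFar N gN hgN W G hG c Ψ hc hsm hinj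
    ⟨t₀, ht₀, himm⟩ hasym
  intro t ht p hp
  -- deep points are at distance `> 1` from `p`
  obtain ⟨t', ht', hdeep⟩ := hfar p 1
  -- split the far part at height `t'`
  have hsplit : Ψ '' (univ ×ˢ Ioo (0 : ℝ) t) ⊆
      Ψ '' (univ ×ˢ Ioo (0 : ℝ) t') ∪ Ψ '' (univ ×ˢ Icc t' t) := by
    rintro _ ⟨x, hx, rfl⟩
    rcases lt_or_ge x.2 t' with h | h
    · exact Or.inl ⟨x, ⟨mem_univ _, hx.2.1, h⟩, rfl⟩
    · exact Or.inr ⟨x, ⟨mem_univ _, h, hx.2.2.le⟩, rfl⟩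
  have hp' := closure_mono hsplit hp
  rw [closure_union] at hp'
  rcases hp' with h1 | h2
  · -- the distance-`1` ball about `p` misses the deep part: contradiction
    have hball : {y : W | G.edist hG p y < 1} ∈ 𝓝 p :=
      PseudoRiemannianMetric.setOf_edist_lt_mem_nhds hG p one_pos
    rw [mem_closure_iff_nhds] at h1
    obtain ⟨y, hyB, ⟨x, hx, rfl⟩⟩ := h1 _ hball
    have hlt : G.edist hG p (Ψ x) < 1 := hyB
    have hgt := hdeep x.1 x.2 hx.2
    simp only [ENNReal.coe_one, Prod.mk.eta] at hgt
    exact absurd hlt (not_lt.2 hgt.le)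
  · -- a compact piece of bounded depth is closed and lies in the collar image
    have hsub : (univ ×ˢ Icc t' t : Set (N × ℝ)) ⊆ univ ×ˢ Ioo (0 : ℝ) 1 :=
      prod_mono Subset.rfl fun l hl ↦ ⟨ht'.1.trans_le hl.1, hl.2.trans_lt ht.2⟩
    have hKc : IsCompact (Ψ '' (univ ×ˢ Icc t' t)) :=
      (isCompact_univ.prod isCompact_Icc).image_of_continuousOn (hsm.continuousOn.mono hsub)
    rw [hKc.isClosed.closure_eq] at h2
    obtain ⟨x, hx, rfl⟩ := h2
    exact ⟨x, hsub hx, rfl⟩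

/-- **Completeness is automatic.** If moreover the far parts `Ψ(N × (0,t))` are co-compact in `W`,
every closed distance ball `{y | d(x,y) ≤ r}` of `(W, G)` is compact: deep points are metrically far
from `x` (`stub_farCollarIsFar`), so the ball lies in some far complement `(Ψ(N × (0,t)))ᶜ`,
compact by hypothesis, and the ball is closed because `d` is continuous (O'Neill 1983, Ch. 5,
Prop. 18). [folklore] -/
theorem isCompact_setOf_edist_le_of_collar
    (hco : ∀ t ∈ Ioo (0 : ℝ) 1, IsCompact (Ψ '' (univ ×ˢ Ioo (0 : ℝ) t))ᶜ) :
    ∀ (x : W) (r : NNReal), IsCompact {y : W | G.edist hG x y ≤ r} := by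
  haveI : LocallyCompactSpace W := ChartedSpace.locallyCompactSpace (EuclideanSpace ℝ (Fin 5)) W
  obtain ⟨t₀, ht₀, himm⟩ := C0AhRecognition.Sketch.stub_farCollarImmersive N gN hgN W G c Ψ hc hasym
  have hfar := C0AhRecognition.Sketch.stub_farCollarIsFar N gN hgN W G hG c Ψ hc hsm hinj
    ⟨t₀, ht₀, himm⟩ hasym
  intro x r
  obtain ⟨t, ht, hdeep⟩ := hfar x r
  have hsub : {y : W | G.edist hG x y ≤ r} ⊆ (Ψ '' (univ ×ˢ Ioo (0 : ℝ) t))ᶜ := by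
    rintro y hy ⟨p, hp, rfl⟩
    have hlt := hdeep p.1 p.2 hp.2
    simp only [Prod.mk.eta] at hlt
    exact absurd hy (not_le.2 hlt)
  have hcont : Continuous fun y ↦ G.edist hG x y :=
    (PseudoRiemannianMetric.continuous_edist hG).comp (Continuous.prodMk_right x)
  exact (hco t ht).of_isClosed_subset (isClosed_le hcont continuous_const) hsub

end Automatic

/-! ## Simple connectivity is automatic (the lever, now unconditional) -/

/-- **A connected `sec ≤ 0` filling carrying the collar is simply connected.** Let `(W, G)` be a
CONNECTED Riemannian 5-manifold with `sec ≤ 0` (for every Levi-Civita connection) carrying the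
crux's collar `Φ : Σ × (0,1) → W` over a homotopy 4-sphere (smooth, injective, co-compact far parts,
`C⁰` cone asymptotics with `c > 0`; the closure clause is automatic,
`closure_image_far_subset_of_collar`). Then `W` is simply connected: it is complete
(`isCompact_setOf_edist_le_of_collar`), so `exp_p : ℝ⁵ → W` is a covering map (Cartan–Hadamard,
tree `HadamardExpCovering.expMap_covering`); the collar gives a far part `U` that is open with
compact frontier, NON-compact closure and closure inside the open embedded simply connected strip
`Φ(Σ × (0,τ))` (`stub_collarSheetData`, p124446); distinct points of a fibre would give disjoint
lifted sheets of `U` in `ℝ⁵` with the same three properties (`stub_coverSheetsSimplyConnected`,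
p124355), and the one-ended `ℝ⁵` holds at most one (`stub_euclideanOneEnd`, p124275).
[cite: HatcherAT2002, §1.3, Prop. 1.39] -/
theorem simplyConnected_of_connectedCollarFilling (S : HomotopySphere 4)
    (g : PseudoRiemannianMetric (𝓡 4) ∞ (EuclideanSpace ℝ (Fin 4)) (TangentSpace (𝓡 4) : S.carrier → Type _))
    (hg : g.IsRiemannian)
    (W : Type) [TopologicalSpace W] [T2Space W] [SecondCountableTopology W]
    [ChartedSpace (EuclideanSpace ℝ (Fin 5)) W] [IsManifold (𝓡 5) ∞ W]
    (G : PseudoRiemannianMetric (𝓡 5) ∞ (EuclideanSpace ℝ (Fin 5)) (TangentSpace (𝓡 5) : W → Type _))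
    (hG : G.IsRiemannian) (c : ℝ) (Φ : S.carrier × ℝ → W) (hc : 0 < c)
    [ConnectedSpace W]
    (hsec : ∀ cov, G.IsLeviCivita cov →
      ∀ (x : W) (X Y : TangentSpace (𝓡 5) x), G.sectionalCurvature cov x X Y ≤ 0)
    (hsm : ContMDiffOn ((𝓡 4).prod 𝓘(ℝ, ℝ)) (𝓡 5) ∞ Φ (univ ×ˢ Ioo (0 : ℝ) 1))
    (hinj : InjOn Φ (univ ×ˢ Ioo (0 : ℝ) 1))
    (hco : ∀ t ∈ Ioo (0 : ℝ) 1, IsCompact (Φ '' (univ ×ˢ Ioo (0 : ℝ) t))ᶜ)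
    (hasym : (∀ ε : ℝ, 0 < ε → ∃ t ∈ Ioo (0 : ℝ) 1, ∀ (x : S.carrier) (l : ℝ), l ∈ Ioo (0 : ℝ) t →
      ∀ (v : TangentSpace (𝓡 4) x) (s : ℝ),
        |G.val (Φ (x, l)) (mfderiv ((𝓡 4).prod 𝓘(ℝ, ℝ)) (𝓡 5) Φ (x, l) (v, s))
            (mfderiv ((𝓡 4).prod 𝓘(ℝ, ℝ)) (𝓡 5) Φ (x, l) (v, s)) -
          c * (s ^ 2 + g.val x v v) / l ^ 2| ≤ ε * (c * (s ^ 2 + g.val x v v) / l ^ 2))) :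
    SimplyConnectedSpace W := by
  -- `W` is path connected (a connected manifold)
  haveI : LocallyPathConnectedSpace W :=
    ChartedSpace.locallyPathConnectedSpace (EuclideanSpace ℝ (Fin 5)) W
  haveI : PathConnectedSpace W := pathConnectedSpace_iff_connectedSpace.2 inferInstance
  -- `ℝ⁵` is simply connected (a real topological vector space is contractible)
  haveI : ContractibleSpace (EuclideanSpace ℝ (Fin 5)) :=
    RealTopologicalVectorSpace.contractibleSpace
  haveI : SimplyConnectedSpace (EuclideanSpace ℝ (Fin 5)) := SimplyConnectedSpace.ofContractible _
  -- the closure clause and completeness are automatic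
  have hcl : ∀ t ∈ Ioo (0 : ℝ) 1,
      closure (Φ '' (univ ×ˢ Ioo (0 : ℝ) t)) ⊆ Φ '' (univ ×ˢ Ioo (0 : ℝ) 1) :=
    closure_image_far_subset_of_collar g hg G hG Φ hc hsm hinj hasym
  have hcpt : ∀ (x : W) (r : NNReal), IsCompact {y : W | G.edist hG x y ≤ r} :=
    isCompact_setOf_edist_le_of_collar g hg G hG Φ hc hsm hinj hasym hco
  -- the Cartan–Hadamard covering `exp_p : ℝ⁵ → W`
  haveI hLC : G.HasLeviCivita := G.hasLeviCivita
  obtain ⟨p⟩ := (inferInstance : Nonempty W)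
  obtain ⟨-, -, hsurj, hcov⟩ := expMap_covering G hG hcpt hsec p
  -- the sheet data from the collar (S3, landed)
  obtain ⟨T, _, _, _, ι, hι, hιo, U, hUo, hUι, hUfr, hUcl⟩ :=
    stub_collarSheetData S g hg W G hG c Φ hc hsm hinj hcl hasym
  -- one end of `ℝ⁵` (S1, landed) + the sheet lemma (S2, landed)
  exact stub_coverSheetsSimplyConnected (EuclideanSpace ℝ (Fin 5)) stub_euclideanOneEnd W _ hcov
    hsurj T ι hι hιo U hUo hUι hUfr hUcl

/-! ## The crux from a connected `sec ≤ 0` filling with the collar -/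

/-- **`AhHadamardFilling` ⇐ connected collar fillings.** If every homotopy 4-sphere `Σ` carries
a Riemannian metric `g` and a CONNECTED Riemannian 5-manifold `(W, G)` with `sec ≤ 0` and the
crux's collar (`c > 0`; `Φ` smooth and injective on `Σ × (0,1)`; co-compact far parts; `C⁰` cone
asymptotics `G ∼ c(dλ² + g)/λ²`) — with NO closure clause, NO completeness and NO simple
connectivity asked — then the crux `AhHadamardFilling` holds: the three missing clauses are
automatic (`closure_image_far_subset_of_collar`, `isCompact_setOf_edist_le_of_collar`,
`simplyConnected_of_connectedCollarFilling`). This is the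
line's Transfer `C⁻ ⇒ crux`, kernel-checked with no `sorry` in its closure. [folklore] -/
theorem ahHadamardFilling_of_connectedCollarFillings
    (h : ∀ (S : HomotopySphere 4),
      ∃ (g : PseudoRiemannianMetric (𝓡 4) ∞ (EuclideanSpace ℝ (Fin 4)) (TangentSpace (𝓡 4) : S.carrier → Type _))
        (_ : g.IsRiemannian) (W : Type) (_ : TopologicalSpace W) (_ : T2Space W)
        (_ : SecondCountableTopology W) (_ : ChartedSpace (EuclideanSpace ℝ (Fin 5)) W)
        (_ : IsManifold (𝓡 5) ∞ W) (_ : ConnectedSpace W)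
        (G : PseudoRiemannianMetric (𝓡 5) ∞ (EuclideanSpace ℝ (Fin 5)) (TangentSpace (𝓡 5) : W → Type _))
        (_ : G.IsRiemannian) (c : ℝ) (Φ : S.carrier × ℝ → W),
        0 < c ∧
        (∀ cov, G.IsLeviCivita cov →
          ∀ (x : W) (X Y : TangentSpace (𝓡 5) x), G.sectionalCurvature cov x X Y ≤ 0) ∧
        ContMDiffOn ((𝓡 4).prod 𝓘(ℝ, ℝ)) (𝓡 5) ∞ Φ (univ ×ˢ Ioo (0 : ℝ) 1) ∧
        InjOn Φ (univ ×ˢ Ioo (0 : ℝ) 1) ∧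
        (∀ t ∈ Ioo (0 : ℝ) 1, IsCompact (Φ '' (univ ×ˢ Ioo (0 : ℝ) t))ᶜ) ∧
        (∀ ε : ℝ, 0 < ε → ∃ t ∈ Ioo (0 : ℝ) 1, ∀ (x : S.carrier) (l : ℝ), l ∈ Ioo (0 : ℝ) t →
          ∀ (v : TangentSpace (𝓡 4) x) (s : ℝ),
            |G.val (Φ (x, l)) (mfderiv ((𝓡 4).prod 𝓘(ℝ, ℝ)) (𝓡 5) Φ (x, l) (v, s))
                (mfderiv ((𝓡 4).prod 𝓘(ℝ, ℝ)) (𝓡 5) Φ (x, l) (v, s)) -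
              c * (s ^ 2 + g.val x v v) / l ^ 2| ≤ ε * (c * (s ^ 2 + g.val x v v) / l ^ 2))) :
    Summit.SmoothPoincare4.SmoothPoincare4.Theses.InformationMetricHadamard.AhHadamardFilling := by
  intro S
  obtain ⟨g, hg, W, i1, i2, i3, i4, i5, i6, G, hG, c, Φ, hc, hsec, hsm, hinj, hco, hasym⟩ := h S
  have hcl : ∀ t ∈ Ioo (0 : ℝ) 1,
      closure (Φ '' (univ ×ˢ Ioo (0 : ℝ) t)) ⊆ Φ '' (univ ×ˢ Ioo (0 : ℝ) 1) :=
    closure_image_far_subset_of_collar g hg G hG Φ hc hsm hinj hasym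
  have hcpt : ∀ (x : W) (r : NNReal), IsCompact {y : W | G.edist hG x y ≤ r} :=
    isCompact_setOf_edist_le_of_collar g hg G hG Φ hc hsm hinj hasym hco
  haveI : SimplyConnectedSpace W :=
    simplyConnected_of_connectedCollarFilling S g hg W G hG c Φ hc hsec hsm hinj hco hasym
  exact ⟨g, hg, W, i1, i2, i3, i4, i5, inferInstance, G, hG, c, Φ, hc, hcpt, hsec, hsm, hinj, hco,
    hcl, hasym⟩

/-! ## The crux from the registered gauge apex S4 (r2 signature) -/

/-- **`AhHadamardFilling` ⇐ the gauge apex `stub_instantonCollarComponentNpc` (r2).** If for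
every (nonempty, `T₃`) homotopy 4-sphere `Σ` there are a Riemannian `g` and a CONNECTED smooth
5-manifold `W` injecting continuously into the charge-one moduli space
`AsdModuliSpace g Σ.orientation 1`, with a Riemannian `G` equal to Hitchin's information metric of
the curvature densities along the injection (Fisher–Rao identity), `sec(G) ≤ 0`, and the crux's
collar `Φ` (smooth, injective, co-compact far parts, `C⁰` cone asymptotics; r2 drops the closure
clause and completeness, both automatic) — the intended witness
being the collar component of `(M₁(Σ,g), g_I)` (Groisser–Murray 1997 Thm 3.1; Hitchin 1990 for the
round anchor) — then `AhHadamardFilling` holds. The gauge conjuncts only PIN the witness; the logic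
is `ahHadamardFilling_of_connectedCollarFillings`. [cite: GroisserMurray1997, Thm 3.1] -/
theorem ahHadamardFilling_of_instantonCollarComponentNpc
    (h : ∀ (S : HomotopySphere 4) [Nonempty S.carrier] [T3Space S.carrier],
      ∃ (g : PseudoRiemannianMetric (𝓡 4) ∞ (EuclideanSpace ℝ (Fin 4)) (TangentSpace (𝓡 4) : S.carrier → Type _))
        (hg : g.IsRiemannian) (W : Type) (_ : TopologicalSpace W) (_ : T2Space W)
        (_ : SecondCountableTopology W) (_ : ChartedSpace (EuclideanSpace ℝ (Fin 5)) W)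
        (_ : IsManifold (𝓡 5) ∞ W) (_ : ConnectedSpace W)
        (G : PseudoRiemannianMetric (𝓡 5) ∞ (EuclideanSpace ℝ (Fin 5)) (TangentSpace (𝓡 5) : W → Type _))
        (_ : G.IsRiemannian) (j : W → AsdModuliSpace g S.orientation 1) (c : ℝ)
        (Φ : S.carrier × ℝ → W),
        Continuous j ∧ Injective j ∧
        (∀ (x : W) (v : TangentSpace (𝓡 5) x),
          G.val x v v =
            ∫ y, (deriv (fun t : ℝ ↦
                (j ((extChartAt (𝓡 5) x).symm
                  (extChartAt (𝓡 5) x x + t • (show EuclideanSpace ℝ (Fin 5) from v)))).density g y) 0) ^ 2 /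
              (j x).density g y ∂(volMeasure g hg)) ∧
        0 < c ∧
        (∀ cov, G.IsLeviCivita cov →
          ∀ (x : W) (X Y : TangentSpace (𝓡 5) x), G.sectionalCurvature cov x X Y ≤ 0) ∧
        ContMDiffOn ((𝓡 4).prod 𝓘(ℝ, ℝ)) (𝓡 5) ∞ Φ (univ ×ˢ Ioo (0 : ℝ) 1) ∧
        InjOn Φ (univ ×ˢ Ioo (0 : ℝ) 1) ∧
        (∀ t ∈ Ioo (0 : ℝ) 1, IsCompact (Φ '' (univ ×ˢ Ioo (0 : ℝ) t))ᶜ) ∧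
        (∀ ε : ℝ, 0 < ε → ∃ t ∈ Ioo (0 : ℝ) 1, ∀ (x : S.carrier) (l : ℝ), l ∈ Ioo (0 : ℝ) t →
          ∀ (v : TangentSpace (𝓡 4) x) (s : ℝ),
            |G.val (Φ (x, l)) (mfderiv ((𝓡 4).prod 𝓘(ℝ, ℝ)) (𝓡 5) Φ (x, l) (v, s))
                (mfderiv ((𝓡 4).prod 𝓘(ℝ, ℝ)) (𝓡 5) Φ (x, l) (v, s)) -
              c * (s ^ 2 + g.val x v v) / l ^ 2| ≤ ε * (c * (s ^ 2 + g.val x v v) / l ^ 2)) ) :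
    Summit.SmoothPoincare4.SmoothPoincare4.Theses.InformationMetricHadamard.AhHadamardFilling := by
  refine ahHadamardFilling_of_connectedCollarFillings fun S ↦ ?_
  -- instances on the cross-section (nonempty; locally compact Hausdorff hence `T₃`)
  haveI : Nonempty S.carrier := Sketch.nonempty_carrier S
  haveI : LocallyCompactSpace S.carrier :=
    ChartedSpace.locallyCompactSpace (EuclideanSpace ℝ (Fin 4)) S.carrier
  haveI : T3Space S.carrier := inferInstance
  obtain ⟨g, hg, W, i1, i2, i3, i4, i5, i6, G, hG, j, c, Φ, -, -, -, hc, hsec, hsm, hinj, hco,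
    hasym⟩ := h S
  exact ⟨g, hg, W, i1, i2, i3, i4, i5, i6, G, hG, c, Φ, hc, hsec, hsm, hinj, hco, hasym⟩

end Summit.SmoothPoincare4.SmoothPoincare4.Cruxes.AhHadamardFilling.UniversalCoverStripsTopology

end
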